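import Mathlib
import HarnessLib
import Summits.HubbardSuperconductivity.HubbardSuperconductivity.Theorems.KLProgrammeKLRegimeWickKernelAntisymm

/-!
# Route `KLProgramme` — ENGINE child gen 5 (stmt-HubbardSuperconductivity-19918 `KLRegimeEngineV14`), stub `stub_engine_step_values`,
# conjunct (E2-v9): the 4-leg kernel of the TWO-LINE (bubble) Wick term at each `2+2` LEG COLOURING, with its sign
# (E2-WICK-ROADMAP §5 (iii-c) step 2, generic half, part 1; cell gate-hubbard-kl, seat p1 g9 = C1 BetaSplit lead lineage)

The second-order Wick term of the step is `−½·dblFold((e^{Δ_×(g)} − 1)(e^{Δ_×(D)}(𝒲⁰𝒲¹)))` (p484175); its two-line part is a combination of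
`dblFold(Δ_×(C₁)(Δ_×(C₂)(a⁰·b¹)))` for cutoff covariances `C₁, C₂` (`klw_rung_pairs`, p487051).  By `kernel_dblFold` (p485455) the `4`-leg kernel
of a folded element at labels `Z = (Z₀,Z₁,Z₂,Z₃)` is the sum over the `2⁴` colourings `s : Fin 4 → Fin 2` (leg `i` read in copy `s i`).  This
file evaluates the six `2+2` colourings of the two-line term (the sequel `…WickBubbleColouringsSum` does the other ten and the sum):

* §0 bookkeeping: `iterDeriv` over `Fin 4`/`Fin 6` tuples splits off the first two derivatives; `m! · kernel F m X = constPart (∂_X F)`;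
  kernels are additive / negate; the sum over `Fin 4 → Fin 2` as sixteen terms (`sum_colourings_four`);
* §1 the six `2+2` colourings: the SORTED ones `(0,0,1,1)` / `(1,1,0,0)` are p487434's Feynman rules (`kernel_bubble_sorted`,
  `kernel_bubble_sorted'`); the interleaved ones reduce to them by `kernel_comp_perm` (p487966): `(0,1,1,0)`, `(1,0,0,1)` with sign `+`
  (3-cycles), `(0,1,0,1)` (a transposition) and `(1,0,1,0)` (a 4-cycle) with sign `−`.  Value of the colouring that puts legs `A₀,A₁` on
  copy `0` (= `a`) and `B₀,B₁` on copy `1` (= `b`):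
  `−4!·Σ_{X,Y,X',Y'} contr C₂ X Y · contr C₁ X' Y' · kernel a 4 (X,X',A₀,A₁) · kernel b 4 (Y,Y',B₀,B₁)`.
  At the pair labels `(k′↑+, Q−k′↓+, Q−k↓−, k↑−)` of `klWickPairAmplitude`: `{Z₂,Z₃}|{Z₀,Z₁}` (colourings `1100`/`0011`) is the
  particle–particle channel, `{Z₀,Z₃}|{Z₁,Z₂}` (`0110`/`1001`) the direct particle–hole channel at transfer `k − k′`, `{Z₀,Z₂}|{Z₁,Z₃}`
  (`0101`/`1010`, sign `−`) the crossed particle–hole channel at `k + k′ − Q` — the Kohn–Luttinger source of E2-DRIVE.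

Generic (commutative `ℚ`-algebra `R`, finite labels `Γ`); proved; no definitions; nothing about the model is asserted.
-/

noncomputable section

namespace Summit.HubbardSuperconductivity.HubbardSuperconductivity.Theorems.KLRegimeWick

set_option linter.dupNamespace false -- summit = problem name (single-conjunct summit), D-0017

open Literature.MathematicalPhysics.QuantumLattice GrassmannAlgebra Finset Matrix

/-! ## §0 Bookkeeping: splitting iterated derivatives, the factorial normalisation, the sixteen colourings -/

section Bookkeeping

variable (R : Type*) [CommRing R] [Algebra ℚ R] {Γ : Type*}

omit [Algebra ℚ R] in
/-- Two derivatives: `∂_{[X,Y]} a = ∂_Y (∂_X a)`. -/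
theorem iterDeriv_two (X Y : Γ) (a : GrassmannAlgebra R Γ) :
    iterDeriv R ![X, Y] a = grassmannDeriv R Y (grassmannDeriv R X a) := by
  rw [iterDeriv_succ_succ_apply, iterDeriv_zero_apply]
  rfl

omit [Algebra ℚ R] in
/-- Four derivatives split `2 + 2`: `∂_W a = ∂_{[W₂,W₃]} (∂_{[W₀,W₁]} a)`. -/
theorem iterDeriv_four_split (W : Fin 4 → Γ) (a : GrassmannAlgebra R Γ) :
    iterDeriv R W a = iterDeriv R ![W 2, W 3] (iterDeriv R ![W 0, W 1] a) := by
  have h : (fun j : Fin 2 => W j.succ.succ) = ![W 2, W 3] := by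
    funext j; fin_cases j <;> rfl
  rw [iterDeriv_succ_succ_apply R W, h, iterDeriv_two R (W 0)]

omit [Algebra ℚ R] in
/-- Six derivatives split `2 + 4`: `∂_W a = ∂_{[W₂,…,W₅]} (∂_{[W₀,W₁]} a)`. -/
theorem iterDeriv_six_split (W : Fin 6 → Γ) (a : GrassmannAlgebra R Γ) :
    iterDeriv R W a = iterDeriv R ![W 2, W 3, W 4, W 5] (iterDeriv R ![W 0, W 1] a) := by
  have h : (fun j : Fin 4 => W j.succ.succ) = ![W 2, W 3, W 4, W 5] := by
    funext j; fin_cases j <;> rfl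
  rw [iterDeriv_succ_succ_apply R W, h, iterDeriv_two R (W 0)]

/-- The factorial normalisation of `kernel`: `m! · kernel F m X = constPart (∂_X F)`. -/
theorem factorial_mul_kernel (F : GrassmannAlgebra R Γ) (m : ℕ) (X : Fin m → Γ) :
    (m.factorial : R) * kernel R F m X = constPart R (iterDeriv R X F) := by
  rw [kernel_def, ← mul_assoc, Algebra.smul_def, mul_one, ← map_natCast (algebraMap ℚ R), ← map_mul,
    mul_inv_cancel₀ (Nat.cast_ne_zero.2 (Nat.factorial_ne_zero m)), map_one, one_mul]

/-- Kernels are additive over finite sums. -/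
theorem kernel_finset_sum {ι : Type*} (s : Finset ι) (f : ι → GrassmannAlgebra R Γ) (m : ℕ) (X : Fin m → Γ) :
    kernel R (∑ i ∈ s, f i) m X = ∑ i ∈ s, kernel R (f i) m X := by
  classical
  induction s using Finset.induction_on with
  | empty => simp
  | insert j s hj ih => rw [Finset.sum_insert hj, Finset.sum_insert hj, kernel_add, ih]

/-- Kernels of a negative. -/
theorem kernel_neg (F : GrassmannAlgebra R Γ) (m : ℕ) (X : Fin m → Γ) : kernel R (-F) m X = -kernel R F m X := by
  rw [← neg_one_smul R F, kernel_smul, neg_one_mul]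

/-- `m!` is a unit of the `ℚ`-algebra `R`. -/
theorem isUnit_factorial (m : ℕ) : IsUnit ((m.factorial : ℕ) : R) := by
  rw [← map_natCast (algebraMap ℚ R)]
  exact (isUnit_iff_ne_zero.2 (Nat.cast_ne_zero.2 (Nat.factorial_ne_zero m))).map _

/-- `constPart (∂_{[A₀,A₁]} ∂_{X'} ∂_X a) = 4! · kernel a 4 (X, X', A₀, A₁)`. -/
theorem constPart_iterDeriv_two_deriv_deriv (A₀ A₁ X X' : Γ) (a : GrassmannAlgebra R Γ) :
    constPart R (iterDeriv R ![A₀, A₁] (grassmannDeriv R X' (grassmannDeriv R X a))) =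
      (Nat.factorial 4 : R) * kernel R a 4 ![X, X', A₀, A₁] := by
  rw [factorial_mul_kernel, iterDeriv_four_split, ← iterDeriv_two]
  rfl

/-- `constPart (∂_{Z} ∂_{X'} ∂_X a) = 6! · kernel a 6 (X, X', Z₀, Z₁, Z₂, Z₃)` for `Z : Fin 4 → Γ`. -/
theorem constPart_iterDeriv_four_deriv_deriv (Z : Fin 4 → Γ) (X X' : Γ) (a : GrassmannAlgebra R Γ) :
    constPart R (iterDeriv R Z (grassmannDeriv R X' (grassmannDeriv R X a))) =
      (Nat.factorial 6 : R) * kernel R a 6 ![X, X', Z 0, Z 1, Z 2, Z 3] := by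
  have hZ : Z = ![Z 0, Z 1, Z 2, Z 3] := by funext i; fin_cases i <;> rfl
  rw [factorial_mul_kernel, iterDeriv_six_split, ← iterDeriv_two]
  conv_lhs => rw [hZ]
  rfl

/-- `constPart (∂_{Y'} ∂_Y b) = 2! · kernel b 2 (Y, Y')`. -/
theorem constPart_deriv_deriv (Y Y' : Γ) (b : GrassmannAlgebra R Γ) :
    constPart R (grassmannDeriv R Y' (grassmannDeriv R Y b)) = (Nat.factorial 2 : R) * kernel R b 2 ![Y, Y'] := by
  rw [factorial_mul_kernel, iterDeriv_two]

omit [Algebra ℚ R] in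
/-- Splitting a sum over `Fin (n+1) → Fin 2` by the value at `0`. -/
theorem sum_fin_succ_arrow {α : Type*} [AddCommMonoid α] {n : ℕ} (f : (Fin (n + 1) → Fin 2) → α) :
    ∑ s, f s = ∑ s : Fin n → Fin 2, f (Fin.cons 0 s) + ∑ s : Fin n → Fin 2, f (Fin.cons 1 s) := by
  rw [← Fintype.sum_equiv (Fin.consEquiv fun _ : Fin (n + 1) => Fin 2) (fun q => f (Fin.consEquiv _ q)) f (fun _ => rfl),
    Fintype.sum_prod_type, Fin.sum_univ_two]
  rfl

omit [Algebra ℚ R] in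
/-- The sum over `Fin 0 → Fin 2` is one term. -/
theorem sum_fin_zero_arrow {α : Type*} [AddCommMonoid α] (f : (Fin 0 → Fin 2) → α) : ∑ s, f s = f ![] := by
  rw [Fintype.sum_unique]
  exact congrArg f (Subsingleton.elim _ _)

omit [Algebra ℚ R] in
/-- **The sixteen leg colourings** of a `4`-leg kernel on the doubled labels. -/
theorem sum_colourings_four {α : Type*} [AddCommMonoid α] (f : (Fin 4 → Fin 2) → α) :
    ∑ s, f s =
      f ![0, 0, 0, 0] + f ![0, 0, 0, 1] + f ![0, 0, 1, 0] + f ![0, 0, 1, 1] +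
      f ![0, 1, 0, 0] + f ![0, 1, 0, 1] + f ![0, 1, 1, 0] + f ![0, 1, 1, 1] +
      f ![1, 0, 0, 0] + f ![1, 0, 0, 1] + f ![1, 0, 1, 0] + f ![1, 0, 1, 1] +
      f ![1, 1, 0, 0] + f ![1, 1, 0, 1] + f ![1, 1, 1, 0] + f ![1, 1, 1, 1] := by
  simp only [sum_fin_succ_arrow, sum_fin_zero_arrow, add_assoc]
  rfl

end Bookkeeping

/-! ## §1 The six `2+2` colourings -/

section TwoTwo

variable (R : Type*) [CommRing R] [Algebra ℚ R] {Γ : Type*} [Fintype Γ] [DecidableEq Γ]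

/-- **Sorted colouring `(0,0,1,1)`** (legs `A₀,A₁` on copy `0` = `a`, `B₀,B₁` on copy `1` = `b`):
`kernel (Δ_×(C₁)Δ_×(C₂)(a⁰b¹)) 4 ((A₀,0),(A₁,0),(B₀,1),(B₁,1)) = −4!·Σ contr C₂ X Y · contr C₁ X' Y' · kernel a 4 (X,X',A₀,A₁) · kernel b 4 (Y,Y',B₀,B₁)`. -/
theorem kernel_bubble_sorted (C₁ C₂ : Matrix Γ Γ R) (a b : GrassmannAlgebra R Γ) (A₀ A₁ B₀ B₁ : Γ) :
    kernel R (grassmannLaplacian R (crossCov R C₁) (grassmannLaplacian R (crossCov R C₂) (dblCopy R 0 a * dblCopy R 1 b))) 4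
        ![(A₀, (0 : Fin 2)), (A₁, 0), (B₀, 1), (B₁, 1)] =
      -((Nat.factorial 4 : R) * ∑ X, ∑ Y, ∑ X', ∑ Y', contr R C₂ X Y * contr R C₁ X' Y' *
        (kernel R a 4 ![X, X', A₀, A₁] * kernel R b 4 ![Y, Y', B₀, B₁])) := by
  refine (isUnit_factorial R 4).mul_right_inj.1 ?_
  rw [factorial_mul_kernel, iterDeriv_four_split]
  rw [show (![(![(A₀, (0 : Fin 2)), (A₁, 0), (B₀, 1), (B₁, 1)] : Fin 4 → Γ × Fin 2) 2,
      (![(A₀, (0 : Fin 2)), (A₁, 0), (B₀, 1), (B₁, 1)] : Fin 4 → Γ × Fin 2) 3] : Fin 2 → Γ × Fin 2) = ![(B₀, (1 : Fin 2)), (B₁, 1)]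
      from rfl,
    show (![(![(A₀, (0 : Fin 2)), (A₁, 0), (B₀, 1), (B₁, 1)] : Fin 4 → Γ × Fin 2) 0,
      (![(A₀, (0 : Fin 2)), (A₁, 0), (B₀, 1), (B₁, 1)] : Fin 4 → Γ × Fin 2) 1] : Fin 2 → Γ × Fin 2) = ![(A₀, (0 : Fin 2)), (A₁, 0)]
      from rfl,
    constPart_bubble_colouring_0011]
  simp only [constPart_iterDeriv_two_deriv_deriv, Finset.mul_sum, mul_neg]
  rw [neg_inj]
  refine Finset.sum_congr rfl fun X _ => Finset.sum_congr rfl fun Y _ => Finset.sum_congr rfl fun X' _ =>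
    Finset.sum_congr rfl fun Y' _ => ?_
  ring

/-- **Sorted colouring `(1,1,0,0)`** (legs `B₀,B₁` on copy `1` listed first, then `A₀,A₁` on copy `0`): the same value. -/
theorem kernel_bubble_sorted' (C₁ C₂ : Matrix Γ Γ R) (a b : GrassmannAlgebra R Γ) (A₀ A₁ B₀ B₁ : Γ) :
    kernel R (grassmannLaplacian R (crossCov R C₁) (grassmannLaplacian R (crossCov R C₂) (dblCopy R 0 a * dblCopy R 1 b))) 4
        ![(B₀, (1 : Fin 2)), (B₁, 1), (A₀, 0), (A₁, 0)] =
      -((Nat.factorial 4 : R) * ∑ X, ∑ Y, ∑ X', ∑ Y', contr R C₂ X Y * contr R C₁ X' Y' *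
        (kernel R a 4 ![X, X', A₀, A₁] * kernel R b 4 ![Y, Y', B₀, B₁])) := by
  refine (isUnit_factorial R 4).mul_right_inj.1 ?_
  rw [factorial_mul_kernel, iterDeriv_four_split]
  rw [show (![(![(B₀, (1 : Fin 2)), (B₁, 1), (A₀, 0), (A₁, 0)] : Fin 4 → Γ × Fin 2) 2,
      (![(B₀, (1 : Fin 2)), (B₁, 1), (A₀, 0), (A₁, 0)] : Fin 4 → Γ × Fin 2) 3] : Fin 2 → Γ × Fin 2) = ![(A₀, (0 : Fin 2)), (A₁, 0)]
      from rfl,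
    show (![(![(B₀, (1 : Fin 2)), (B₁, 1), (A₀, 0), (A₁, 0)] : Fin 4 → Γ × Fin 2) 0,
      (![(B₀, (1 : Fin 2)), (B₁, 1), (A₀, 0), (A₁, 0)] : Fin 4 → Γ × Fin 2) 1] : Fin 2 → Γ × Fin 2) = ![(B₀, (1 : Fin 2)), (B₁, 1)]
      from rfl,
    constPart_bubble_colouring_1100]
  simp only [constPart_iterDeriv_two_deriv_deriv, Finset.mul_sum, mul_neg]
  rw [neg_inj]
  refine Finset.sum_congr rfl fun X _ => Finset.sum_congr rfl fun Y _ => Finset.sum_congr rfl fun X' _ =>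
    Finset.sum_congr rfl fun Y' _ => ?_
  ring

/-- Colouring `(1,1,0,0)` at labels `Z`: legs `Z₂,Z₃` on `a`, `Z₀,Z₁` on `b` (the particle–particle colouring at the pair labels). -/
theorem kernel_bubble_colouring_1100 (C₁ C₂ : Matrix Γ Γ R) (a b : GrassmannAlgebra R Γ) (Z : Fin 4 → Γ) :
    kernel R (grassmannLaplacian R (crossCov R C₁) (grassmannLaplacian R (crossCov R C₂) (dblCopy R 0 a * dblCopy R 1 b))) 4
        (fun i => (Z i, (![1, 1, 0, 0] : Fin 4 → Fin 2) i)) =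
      -((Nat.factorial 4 : R) * ∑ X, ∑ Y, ∑ X', ∑ Y', contr R C₂ X Y * contr R C₁ X' Y' *
        (kernel R a 4 ![X, X', Z 2, Z 3] * kernel R b 4 ![Y, Y', Z 0, Z 1])) := by
  have hW : (fun i => (Z i, (![1, 1, 0, 0] : Fin 4 → Fin 2) i)) = ![(Z 0, (1 : Fin 2)), (Z 1, 1), (Z 2, 0), (Z 3, 0)] := by
    funext i; fin_cases i <;> rfl
  rw [hW, kernel_bubble_sorted']

/-- Colouring `(0,0,1,1)`: legs `Z₀,Z₁` on `a`, `Z₂,Z₃` on `b` (the other particle–particle colouring). -/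
theorem kernel_bubble_colouring_0011 (C₁ C₂ : Matrix Γ Γ R) (a b : GrassmannAlgebra R Γ) (Z : Fin 4 → Γ) :
    kernel R (grassmannLaplacian R (crossCov R C₁) (grassmannLaplacian R (crossCov R C₂) (dblCopy R 0 a * dblCopy R 1 b))) 4
        (fun i => (Z i, (![0, 0, 1, 1] : Fin 4 → Fin 2) i)) =
      -((Nat.factorial 4 : R) * ∑ X, ∑ Y, ∑ X', ∑ Y', contr R C₂ X Y * contr R C₁ X' Y' *
        (kernel R a 4 ![X, X', Z 0, Z 1] * kernel R b 4 ![Y, Y', Z 2, Z 3])) := by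
  have hW : (fun i => (Z i, (![0, 0, 1, 1] : Fin 4 → Fin 2) i)) = ![(Z 0, (0 : Fin 2)), (Z 1, 0), (Z 2, 1), (Z 3, 1)] := by
    funext i; fin_cases i <;> rfl
  rw [hW, kernel_bubble_sorted]

/-- Colouring `(0,1,1,0)`: legs `Z₀,Z₃` on `a`, `Z₁,Z₂` on `b`; reduced to the sorted one by the 3-cycle `(1 2 3)`, sign `+`
(the direct particle–hole colouring at the pair labels). -/
theorem kernel_bubble_colouring_0110 (C₁ C₂ : Matrix Γ Γ R) (a b : GrassmannAlgebra R Γ) (Z : Fin 4 → Γ) :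
    kernel R (grassmannLaplacian R (crossCov R C₁) (grassmannLaplacian R (crossCov R C₂) (dblCopy R 0 a * dblCopy R 1 b))) 4
        (fun i => (Z i, (![0, 1, 1, 0] : Fin 4 → Fin 2) i)) =
      -((Nat.factorial 4 : R) * ∑ X, ∑ Y, ∑ X', ∑ Y', contr R C₂ X Y * contr R C₁ X' Y' *
        (kernel R a 4 ![X, X', Z 0, Z 3] * kernel R b 4 ![Y, Y', Z 1, Z 2])) := by
  let σ : Equiv.Perm (Fin 4) := ⟨![0, 2, 3, 1], ![0, 3, 1, 2], by decide, by decide⟩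
  have hσ : Equiv.Perm.sign σ = 1 := by decide
  have hW : (fun i => (Z i, (![0, 1, 1, 0] : Fin 4 → Fin 2) i)) = ![(Z 0, (0 : Fin 2)), (Z 3, 0), (Z 1, 1), (Z 2, 1)] ∘ σ := by
    funext i; fin_cases i <;> rfl
  rw [hW, kernel_comp_perm, hσ, kernel_bubble_sorted]
  simp

/-- Colouring `(1,0,0,1)`: legs `Z₁,Z₂` on `a`, `Z₀,Z₃` on `b`; 3-cycle, sign `+` (direct particle–hole, mirrored). -/
theorem kernel_bubble_colouring_1001 (C₁ C₂ : Matrix Γ Γ R) (a b : GrassmannAlgebra R Γ) (Z : Fin 4 → Γ) :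
    kernel R (grassmannLaplacian R (crossCov R C₁) (grassmannLaplacian R (crossCov R C₂) (dblCopy R 0 a * dblCopy R 1 b))) 4
        (fun i => (Z i, (![1, 0, 0, 1] : Fin 4 → Fin 2) i)) =
      -((Nat.factorial 4 : R) * ∑ X, ∑ Y, ∑ X', ∑ Y', contr R C₂ X Y * contr R C₁ X' Y' *
        (kernel R a 4 ![X, X', Z 1, Z 2] * kernel R b 4 ![Y, Y', Z 0, Z 3])) := by
  let σ : Equiv.Perm (Fin 4) := ⟨![2, 0, 1, 3], ![1, 2, 0, 3], by decide, by decide⟩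
  have hσ : Equiv.Perm.sign σ = 1 := by decide
  have hW : (fun i => (Z i, (![1, 0, 0, 1] : Fin 4 → Fin 2) i)) = ![(Z 1, (0 : Fin 2)), (Z 2, 0), (Z 0, 1), (Z 3, 1)] ∘ σ := by
    funext i; fin_cases i <;> rfl
  rw [hW, kernel_comp_perm, hσ, kernel_bubble_sorted]
  simp

/-- Colouring `(0,1,0,1)`: legs `Z₀,Z₂` on `a`, `Z₁,Z₃` on `b`; a transposition, sign `−` (the CROSSED particle–hole colouring). -/
theorem kernel_bubble_colouring_0101 (C₁ C₂ : Matrix Γ Γ R) (a b : GrassmannAlgebra R Γ) (Z : Fin 4 → Γ) :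
    kernel R (grassmannLaplacian R (crossCov R C₁) (grassmannLaplacian R (crossCov R C₂) (dblCopy R 0 a * dblCopy R 1 b))) 4
        (fun i => (Z i, (![0, 1, 0, 1] : Fin 4 → Fin 2) i)) =
      (Nat.factorial 4 : R) * ∑ X, ∑ Y, ∑ X', ∑ Y', contr R C₂ X Y * contr R C₁ X' Y' *
        (kernel R a 4 ![X, X', Z 0, Z 2] * kernel R b 4 ![Y, Y', Z 1, Z 3]) := by
  let σ : Equiv.Perm (Fin 4) := ⟨![0, 2, 1, 3], ![0, 2, 1, 3], by decide, by decide⟩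
  have hσ : Equiv.Perm.sign σ = -1 := by decide
  have hW : (fun i => (Z i, (![0, 1, 0, 1] : Fin 4 → Fin 2) i)) = ![(Z 0, (0 : Fin 2)), (Z 2, 0), (Z 1, 1), (Z 3, 1)] ∘ σ := by
    funext i; fin_cases i <;> rfl
  rw [hW, kernel_comp_perm, hσ, kernel_bubble_sorted]
  simp

/-- Colouring `(1,0,1,0)`: legs `Z₁,Z₃` on `a`, `Z₀,Z₂` on `b`; a 4-cycle, sign `−` (crossed particle–hole, mirrored). -/
theorem kernel_bubble_colouring_1010 (C₁ C₂ : Matrix Γ Γ R) (a b : GrassmannAlgebra R Γ) (Z : Fin 4 → Γ) :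
    kernel R (grassmannLaplacian R (crossCov R C₁) (grassmannLaplacian R (crossCov R C₂) (dblCopy R 0 a * dblCopy R 1 b))) 4
        (fun i => (Z i, (![1, 0, 1, 0] : Fin 4 → Fin 2) i)) =
      (Nat.factorial 4 : R) * ∑ X, ∑ Y, ∑ X', ∑ Y', contr R C₂ X Y * contr R C₁ X' Y' *
        (kernel R a 4 ![X, X', Z 1, Z 3] * kernel R b 4 ![Y, Y', Z 0, Z 2]) := by
  let σ : Equiv.Perm (Fin 4) := ⟨![2, 0, 3, 1], ![1, 3, 0, 2], by decide, by decide⟩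
  have hσ : Equiv.Perm.sign σ = -1 := by decide
  have hW : (fun i => (Z i, (![1, 0, 1, 0] : Fin 4 → Fin 2) i)) = ![(Z 1, (0 : Fin 2)), (Z 3, 0), (Z 0, 1), (Z 2, 1)] ∘ σ := by
    funext i; fin_cases i <;> rfl
  rw [hW, kernel_comp_perm, hσ, kernel_bubble_sorted]
  simp

end TwoTwo

end Summit.HubbardSuperconductivity.HubbardSuperconductivity.Theorems.KLRegimeWick

end
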